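/-
Copyright (c) 2026 the pub-hodgecm-mathlib formalisation cell (harness21).  Prover seat hodgecm-mathlib-F0P3a-p04 (g32): E1 row 47d (M3) «THE LOCAL REPRESENTATION DATA OF THE MACKEY
DICTIONARY, CONSTRUCTED» (the representation-side binders `σc τ′ σT σQ χ σtw Eig` of ★ 47d-(α) `finrank_intertwiningMap_smoothIndRep_eq_sum_finrank_eigen` ∕ ★ row 60, as ONE
∃-package per family of representatives; offered to the row-61 pen F0P2-p06 (g22) 04:20:08Z), over ★ (α), ★ 47d-G3 and ★ 41d-II, 2026-09-03.
-/
import Literature.NumberTheory.Automorphic.SchneiderStuhlerEPInducedTraceMackey     -- ★ 47d (α): `isSmooth_twist_of_surjective`, `twist_apply_coe_eq`; brings ★ 47b `mem_subgroupOf_map_conj_inv_iff`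
import Literature.NumberTheory.Automorphic.IntertwiningMapCharacterCoinvariants   -- ★ 47d G3: `exists_twistInv`
import Literature.NumberTheory.Automorphic.SchneiderStuhlerTreeComplexAction      -- ★ 41d-II: `exists_rep_submodule`
import HarnessLib

/-!
# The local representation data of the Mackey dictionary, constructed

Topic `NumberTheory/Automorphic`; namespace `Representation`; THEOREMS ONLY (no definition, instance, notation or named fact); imports ★ 47d-(α), ★ 47d-G3, ★ 41d-II, HarnessLib.
Cell `pub/hodgecm-mathlib` (D-0151), crux H413 = `stmt-HodgeConjecture-24833`, lane `--supports`; E1 row 47d, brick (M3) (sibling of ★ (M2) `SchneiderStuhlerTreeLocalModel`).  Count-neutral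
generic base layer; HC_CM is proved only modulo the 7 printed citations (2 remaining named inputs: hLiu418 = `stmt-HodgeConjecture-24832`, h413 = `stmt-HodgeConjecture-24833`) until
rung 0 closes.

THE LOCAL DATA.  ★ (α) `finrank_intertwiningMap_smoothIndRep_eq_sum_finrank_eigen` (and after it ★ row 60, ★ 47d HEAD v2, row 61) is hypothesis-style in the local representation data of
each Mackey representative `g_j`: the conjugated target `σc j` of ★ 47b (`hσc`), the `T_j`-representation `τ′ j` on `E′_j` (`hτ′`), the restriction `σT j` of `σ` to `T_j ≤ H` (`hσT`, `hWN`),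
the local Jacquet module `Q j = (E′_j)_{N_j}` with its quotient map `q j` (`hq hker`), the action `σQ j` of the compact torus `C_j` on it (`hσQ`), the character `χ j = χ̃|_{C_j}` (`hχ`), the
smooth twist `σtw j = χ̃⁻¹ ⊗ Q j` (`hsm htw`) and the `χ_j`-eigenspace `Eig j` (`hEig`), with `Q j` finite-dimensional.  None of these has a constructor in the tree (only ★ 41d-II
`exists_rep_submodule` for `τ′` and ★ G3 `exists_twistInv`).  This file CONSTRUCTS them all at once, for an arbitrary family of representatives, from: `ρ` smooth; `σ` acting on the
line `W` by a character `χH : H →* kˣ` with OPEN kernel (`hσχ hχo`); subgroups `T j` with ★ (α)'s `hT`; `T_j`-stable finite-dimensional `E′_j ≤ V` (`hE′T`); subgroups `C j, N j ≤ T j`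
with `N j` NORMAL in `T j` and `χH` trivial on `N j` (`hNχ`) — at the Bruhat–Tits datum `T_j = B ∩ P_{g_j F}`, `E′_j = V^{U_{g_j F}}`, `N_j = N ∩ P_{g_j F}`, `C_j` the compact torus.
* §1 `exists_conjRep`: the conjugated targets `σc j` on `{s ∈ K | g_j s g_j⁻¹ ∈ H}` (the letter `hσc` of ★ 47b ∕ ★ (α)); `exists_restrictRep_of_forall_mem`: the restrictions
  `σT j` of `σ` to `T j ≤ H` (`hσT`); `exists_eigenSubmodule`: the simultaneous `χ`-eigenspace of a representation as a submodule (`hEig`, ★ 4χ(a) currency).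
* §2 **`exists_mackeyLocalData`** — THE PACKAGE: `∃ σc τ′ σT σQ χ σtw Eig` with `hσc ∧ hτ′ ∧ hσT ∧ hWN ∧ hσQ ∧ hker ∧ hχ ∧ hsm ∧ htw ∧ hEig ∧ FiniteDimensional (Q j)`, where
  `Q j := Coinvariants ((τ′ j).comp (N j).subtype)` and `q j := Coinvariants.mk _` (so ★ (α)'s `hq` is Mathlib's `Coinvariants.mk_surjective`).  After one `obtain`, the
  representation-side binders of ★ (α) ∕ ★ row 60 are in hand; the geometric ones (`hcover hdisj hdec hC`, the torus index (L2) and 55-B's orbit data) stay the datum's.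

## References
* [BernsteinZelevinsky1977] I. N. Bernstein, A. V. Zelevinsky, *Induced representations of reductive 𝔭-adic groups I*, Ann. Sci. ÉNS 10 (1977), §2.3, Thm 5.2 (geometric lemma).
* [BernsteinZelevinsky1976] I. N. Bernstein, A. V. Zelevinsky, *Representations of the group `GL(n,F)`*, Russian Math. Surveys 31 (1976), §2.3.
* [Casselman1995] W. Casselman, *Introduction to the theory of admissible representations of `p`-adic reductive groups* (1995 notes), §3.1–§3.2, §6.3.
* [SchneiderStuhler1997] P. Schneider, U. Stuhler, *Representation theory and sheaves on the Bruhat–Tits building*, Publ. Math. IHÉS 85 (1997), §III.4 (Lemma III.4.13, Lemma III.4.18).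
-/

set_option autoImplicit false

namespace Representation

open Function Module

/-! ## §1 Three constructors: conjugated targets, restrictions, eigen-submodules -/

section Constructors

variable {k Γ W : Type*} [CommRing k] [Group Γ] [AddCommGroup W] [Module k W] {H K : Subgroup Γ} (σ : Representation k H W)

/-- **THE CONJUGATED TARGETS `σ^{g_j}`** of ★ 47b's Mackey formula: representations `σc j` of `{s ∈ K | g_j s g_j⁻¹ ∈ H}` on `W` with `σc j s = σ (g_j s g_j⁻¹)` (the letter `hσc`).
[cite: BernsteinZelevinsky1977, §2.3, Thm 5.2] -/
theorem exists_conjRep {ι : Type*} (g : ι → Γ) :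
    ∃ σc : ∀ j, Representation k ↥((H.map (MulAut.conj (g j)⁻¹).toMonoidHom).subgroupOf K) W,
      ∀ (j : ι) (s : ↥((H.map (MulAut.conj (g j)⁻¹).toMonoidHom).subgroupOf K)),
        σc j s = σ ⟨g j * ((s : K) : Γ) * (g j)⁻¹, (mem_subgroupOf_map_conj_inv_iff H K (g j) s).1 s.2⟩ := by
  have hf : ∀ j, ∃ f : ↥((H.map (MulAut.conj (g j)⁻¹).toMonoidHom).subgroupOf K) →* H,
      ∀ s, f s = ⟨g j * ((s : K) : Γ) * (g j)⁻¹, (mem_subgroupOf_map_conj_inv_iff H K (g j) s).1 s.2⟩ := fun j =>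
    ⟨{ toFun := fun s => ⟨g j * ((s : K) : Γ) * (g j)⁻¹, (mem_subgroupOf_map_conj_inv_iff H K (g j) s).1 s.2⟩
       map_one' := Subtype.ext (by simp)
       map_mul' := fun s s' => Subtype.ext (by
         show g j * (((s : K) : Γ) * ((s' : K) : Γ)) * (g j)⁻¹ = g j * ((s : K) : Γ) * (g j)⁻¹ * (g j * ((s' : K) : Γ) * (g j)⁻¹)
         simp only [mul_assoc, inv_mul_cancel_left]) }, fun s => rfl⟩
  choose f hf using hf
  exact ⟨fun j => σ.comp (f j), fun j s => by simp only [MonoidHom.comp_apply, hf]⟩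

/-- **THE RESTRICTIONS `σ|_{T_j}`** for subgroups `T j` contained in `H` (★ (α)'s `T_j = H ∩ g_j K g_j⁻¹`): representations `σT j` of `T j` on `W` with `σT j t = σ h` whenever
`↑h = ↑t` (the letter `hσT`). [cite: BernsteinZelevinsky1977, §2.3] -/
theorem exists_restrictRep_of_forall_mem {ι : Type*} (T : ι → Subgroup Γ) (hTH : ∀ j, ∀ y ∈ T j, y ∈ H) :
    ∃ σT : ∀ j, Representation k (T j) W, ∀ (j : ι) (t : T j) (h : H), (h : Γ) = (t : Γ) → σT j t = σ h :=
  ⟨fun j => σ.comp (Subgroup.inclusion (hTH j)), fun j t h hht => by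
    simp only [MonoidHom.comp_apply]
    exact congrArg σ (Subtype.ext hht.symm)⟩

/-- **THE SIMULTANEOUS `χ`-EIGENSPACE AS A SUBMODULE** (★ 4χ(a) ∕ ★ (α) currency `hEig`): for endomorphisms `T c` and scalars `χ c` there is a submodule `Eig` with
`v ∈ Eig ↔ ∀ c, T c v = χ c • v`. [cite: BernsteinZelevinsky1976, §2.3] -/
theorem exists_eigenSubmodule {Q : Type*} [AddCommGroup Q] [Module k Q] {C : Type*} (T : C → Q →ₗ[k] Q) (χ : C → k) :
    ∃ Eig : Submodule k Q, ∀ v, v ∈ Eig ↔ ∀ c, T c v = χ c • v := by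
  refine ⟨⨅ c, LinearMap.ker (T c - χ c • LinearMap.id), fun v => ?_⟩
  simp only [Submodule.mem_iInf, LinearMap.mem_ker, LinearMap.sub_apply, LinearMap.smul_apply, LinearMap.id_apply, sub_eq_zero]

end Constructors

/-! ## §2 The local data package -/

section LocalData

variable {k Γ V W : Type*} [Field k] [Group Γ] [TopologicalSpace Γ] [IsTopologicalGroup Γ] [AddCommGroup V] [Module k V] [AddCommGroup W] [Module k W]
  (ρ : Representation k Γ V) {H K : Subgroup Γ} (σ : Representation k H W)

/-- **THE LOCAL REPRESENTATION DATA OF THE MACKEY DICTIONARY, CONSTRUCTED.**  For `ρ` smooth, `σ` given on `W` by a character `χH` of `H` with open kernel, representatives `g j`,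
subgroups `T j = H ∩ g_j K g_j⁻¹` (`hT`), `T_j`-stable finite-dimensional `E′_j ≤ V` (`hE′T`), and `C j, N j ≤ T j` with `N j` normal and `χH` trivial on `N j` (`hNχ`), there are
`σc τ′ σT σQ χ σtw Eig` with — in the letters of ★ (α) `finrank_intertwiningMap_smoothIndRep_eq_sum_finrank_eigen` and ★ row 60, at `Q j := Coinvariants ((τ′ j).comp (N j).subtype)`,
`q j := Coinvariants.mk _` — `hσc`, `hτ′`, `hσT`, `hWN`, `hσQ`, `hker`, `hχ` (for `χ j = χH|_{C_j}`), `hsm` (★ (α) §4), `htw`, `hEig`, and `FiniteDimensional k (Q j)`.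
[cite: BernsteinZelevinsky1977, §2.3, Thm 5.2] [cite: Casselman1995, §3.1–§3.2, §6.3] [cite: SchneiderStuhler1997, §III.4 Lemma III.4.13, Lemma III.4.18] -/
theorem exists_mackeyLocalData (hρ : ρ.IsSmooth) (χH : H →* kˣ) (hσχ : ∀ (h : H) (w : W), σ h w = ((χH h : kˣ) : k) • w) (hχo : IsOpen (χH.ker : Set H))
    {ι : Type*} (g : ι → Γ) (T : ι → Subgroup Γ) (hT : ∀ (j : ι) (y : Γ), y ∈ T j ↔ y ∈ H ∧ (g j)⁻¹ * y * g j ∈ K)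
    (E' : ι → Submodule k V) (hE'T : ∀ (j : ι), ∀ t ∈ T j, ∀ v ∈ E' j, ρ t v ∈ E' j) [∀ j, FiniteDimensional k (E' j)]
    (C N : ∀ j, Subgroup (T j)) [∀ j, (N j).Normal] (hNχ : ∀ (j : ι) (n : N j) (hn : ((n : T j) : Γ) ∈ H), χH ⟨((n : T j) : Γ), hn⟩ = 1) :
    ∃ (σc : ∀ j, Representation k ↥((H.map (MulAut.conj (g j)⁻¹).toMonoidHom).subgroupOf K) W)
      (τ' : ∀ j, Representation k (T j) (E' j)) (σT : ∀ j, Representation k (T j) W)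
      (σQ : ∀ j, Representation k (C j) (Coinvariants ((τ' j).comp (N j).subtype))) (χ : ∀ j, C j →* kˣ)
      (σtw : ∀ j, Representation k (T j) (Coinvariants ((τ' j).comp (N j).subtype))) (Eig : ∀ j, Submodule k (Coinvariants ((τ' j).comp (N j).subtype))),
      (∀ (j : ι) (s : ↥((H.map (MulAut.conj (g j)⁻¹).toMonoidHom).subgroupOf K)),
          σc j s = σ ⟨g j * ((s : K) : Γ) * (g j)⁻¹, (mem_subgroupOf_map_conj_inv_iff H K (g j) s).1 s.2⟩) ∧
      (∀ (j : ι) (t : T j) (e : E' j), ((τ' j t e : E' j) : V) = ρ (t : Γ) e) ∧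
      (∀ (j : ι) (t : T j) (h : H), (h : Γ) = (t : Γ) → σT j t = σ h) ∧
      (∀ (j : ι), ∀ n ∈ N j, σT j n = 1) ∧
      (∀ (j : ι) (c : C j) (e : E' j),
          Coinvariants.mk ((τ' j).comp (N j).subtype) (τ' j (c : T j) e) = σQ j c (Coinvariants.mk ((τ' j).comp (N j).subtype) e)) ∧
      (∀ j, LinearMap.ker (Coinvariants.mk ((τ' j).comp (N j).subtype)) = Coinvariants.ker ((τ' j).comp (N j).subtype)) ∧
      (∀ (j : ι) (c : C j) (w : W), σT j (c : T j) w = ((χ j c : kˣ) : k) • w) ∧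
      (∀ j, (σtw j).IsSmooth) ∧
      (∀ (j : ι) (c : C j) (v : Coinvariants ((τ' j).comp (N j).subtype)), σtw j (c : T j) v = ((χ j c : kˣ) : k)⁻¹ • σQ j c v) ∧
      (∀ (j : ι) (v : Coinvariants ((τ' j).comp (N j).subtype)), v ∈ Eig j ↔ ∀ c : C j, σQ j c v = ((χ j c : kˣ) : k) • v) ∧
      (∀ j, FiniteDimensional k (Coinvariants ((τ' j).comp (N j).subtype))) := by
  -- `T j ≤ H`
  have hTH : ∀ j, ∀ y ∈ T j, y ∈ H := fun j y hy => ((hT j y).1 hy).1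
  -- the seven objects
  obtain ⟨σc, hσc⟩ := exists_conjRep (K := K) σ g
  choose τ' hτ' using fun j => exists_rep_submodule ρ (T j) (E' j) (hE'T j)
  obtain ⟨σT, hσT⟩ := exists_restrictRep_of_forall_mem σ T hTH
  -- the character of `T j` and of `C j`
  have hχT : ∀ (j : ι) (t : T j) (w : W), σT j t w = ((χH (Subgroup.inclusion (hTH j) t) : kˣ) : k) • w := fun j t w => by
    rw [hσT j t (Subgroup.inclusion (hTH j) t) rfl, hσχ]
  choose σtw hσtw using fun j => exists_twistInv ((τ' j).toCoinvariants (N j)) (χH.comp (Subgroup.inclusion (hTH j)))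
  obtain ⟨Eig, hEig⟩ : ∃ Eig : ∀ j, Submodule k (Coinvariants ((τ' j).comp (N j).subtype)), ∀ (j : ι) (v : Coinvariants ((τ' j).comp (N j).subtype)),
      v ∈ Eig j ↔ ∀ c : C j, ((τ' j).toCoinvariants (N j) (c : T j) : _ →ₗ[k] _) v = (((χH.comp (Subgroup.inclusion (hTH j))).comp (C j).subtype c : kˣ) : k) • v := by
    choose Eig hEig using fun j => exists_eigenSubmodule (fun c : C j => ((τ' j).toCoinvariants (N j) (c : T j) : _ →ₗ[k] _))
      (fun c => (((χH.comp (Subgroup.inclusion (hTH j))).comp (C j).subtype c : kˣ) : k))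
    exact ⟨Eig, hEig⟩
  refine ⟨σc, τ', σT, fun j => ((τ' j).toCoinvariants (N j)).comp (C j).subtype, fun j => (χH.comp (Subgroup.inclusion (hTH j))).comp (C j).subtype, σtw, Eig,
    hσc, hτ', hσT, fun j n hn => ?_, fun j c e => rfl, fun j => Submodule.ker_mkQ _, fun j c w => hχT j c w, fun j => ?_, fun j c v => ?_, hEig, fun j => inferInstance⟩
  · -- `hWN`: `σ` is trivial on `N j`
    apply LinearMap.ext
    intro w
    rw [hχT, show χH (Subgroup.inclusion (hTH j) n) = 1 from hNχ j ⟨n, hn⟩ (hTH j _ n.2), Units.val_one, one_smul, Module.End.one_apply]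
  · -- `hsm`: ★ (α) §4 with `χT = χH ∘ (T j ↪ H)`, whose kernel is open by continuity of the inclusion
    refine isSmooth_twist_of_surjective ρ hρ (hτ' j) (Coinvariants.mk _) (Coinvariants.mk_surjective _) (χT := χH.comp (Subgroup.inclusion (hTH j))) ?_
      (σtw := σtw j) fun t e => ?_
    · have hcont : Continuous (Subgroup.inclusion (hTH j) : T j → H) := continuous_inclusion (hTH j)
      have hset : ((χH.comp (Subgroup.inclusion (hTH j))).ker : Set (T j)) = Subgroup.inclusion (hTH j) ⁻¹' (χH.ker : Set H) := by
        ext t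
        simp only [SetLike.mem_coe, MonoidHom.mem_ker, MonoidHom.comp_apply, Set.mem_preimage]
      rw [hset]
      exact hχo.preimage hcont
    · rw [hσtw, toCoinvariants_mk]
  · -- `htw` on `C j`
    rw [hσtw]
    rfl

end LocalData

end Representation
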